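import Mathlib
import Summits.Ventures.PercRepro2.Defs
import Summits.Ventures.PercRepro2.Graph
import Summits.Ventures.PercRepro2.OneColourSwitch
import Summits.Ventures.PercRepro2.RegionHubSign
import Summits.Ventures.PercRepro2.SideSwitch
import Summits.Ventures.PercRepro2.TermSwitchDefs
import Summits.Ventures.PercRepro2.M9NoPocketDefs
import Summits.Ventures.PercRepro2.M9GeneralDSplit
import Summits.Ventures.PercRepro2.M9PsiOneDefs
import Summits.Ventures.PercRepro2.M9PsiOneWorlds
import Summits.Ventures.PercRepro2.M9PsiOneWorldsM
import Summits.Ventures.PercRepro2.M9PsiOneSurvive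
import Summits.Ventures.PercRepro2.M9PsiOneLink
import Summits.Ventures.PercRepro2.M9PsiOneInj

/-!
# The partner `Ψ₁ ω` is a hub–dead-end point (blind cell PercRepro2, p3 g31, 2026-08-28;
`proofs/P3-PAYMENT.md` §2, claim (v))

A joined `W`-vertex `y` of `ω` that is `W`-joined to `{r, s}` inside its block is `Y`-joined to
`{r, s}` in `Ψ₁ ω` (the block's edges are flipped: `mem_K2_psiOne_of_rooted`), and `d`'s edge to
`y` is kept `W`: so `y` lies in both worlds of the terminal set `{r, s, d}` of `Ψ₁ ω` — a dead
end.  Hence `Ψ₁ ω` is an `HD` colouring (`HD_psiOne`).  Own work; std axioms.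
-/

namespace Summit.Ventures.PercRepro2

namespace NoPocket

open Finset Classical RegionHub OneColourSwitch SideSwitch TermSwitch

variable {V : Type*} {E : Type*}

section Dirty

variable {ends : E → Sym2 V} {p q r s d : V} {ω : Config E}

variable (h : IsEX ends p q r s d ω)
include h

/-- `ω` and `Ψ₁ ω` are opposite on the non-loop edges inside a joined `W`-block with `r, s`. -/
lemma flip_on_Wblock {y : V} (hy : y ∈ joinedW ends r s d ω) (hrs : ∀ e, ends e ≠ s(r, s)) :
    ∀ e a b, a ≠ b → a ∈ blockIn ends (Mcore ends r s d ω) y ∪ {r, s} →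
      b ∈ blockIn ends (Mcore ends r s d ω) y ∪ {r, s} → ends e = s(a, b) →
        OneColourSwitch.compl ω e = psiOne ends r s d ω e := by
  intro e a b hab ha hb hends
  have hBM : blockIn ends (Mcore ends r s d ω) y ⊆ Mcore ends r s d ω :=
    blockIn_subset (joinedW_subset_Mcore hy)
  have hnot : ∀ z ∈ blockIn ends (Mcore ends r s d ω) y ∪ {r, s},
      z ∉ joinedY ends r s d ω ∪ linkSetY ends r s d ω ∧ z ≠ d := by
    rintro z (hz | hz)
    · exact ⟨Mcore_not_mem_union h.done (hBM hz), (hBM hz).2.2.2⟩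
    · simp only [Set.mem_insert_iff, Set.mem_singleton_iff] at hz
      rcases hz with rfl | rfl
      · exact ⟨term_not_mem_union (Or.inl rfl), fun hd => h.hr hd.symm⟩
      · exact ⟨term_not_mem_union (Or.inr rfl), fun hd => h.hs hd.symm⟩
  have hk : e ∉ keptEdges ends r s d ω :=
    not_kept hends (hnot a ha).1 (hnot b hb).1 (fun had => ((hnot a ha).2 had).elim)
      (fun hbd => ((hnot b hb).2 hbd).elim)
  rw [psiOne_of_not_kept hk]
  rfl

/-- **A joined `W`-vertex `W`-joined to `{r, s}` inside its block is in the `Y`-world of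
`Ψ₁ ω`.** -/
theorem mem_K2_psiOne_of_rooted {y : V} (hy : y ∈ joinedW ends r s d ω)
    (hrs : ∀ e, ends e ≠ s(r, s)) {t : V} (ht : t = r ∨ t = s)
    (hc : Conn ends (restrictTo ends (OneColourSwitch.compl ω)
      (blockIn ends (Mcore ends r s d ω) y ∪ {r, s})) t y) :
    y ∈ K2 ends r s (psiOne ends r s d ω) := by
  have hc' : Conn ends (restrictTo ends (psiOne ends r s d ω)
      (blockIn ends (Mcore ends r s d ω) y ∪ {r, s})) t y :=
    conn_restrictTo_transfer (flip_on_Wblock h hy hrs) hc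
  have hle : restrictTo ends (psiOne ends r s d ω) (blockIn ends (Mcore ends r s d ω) y ∪ {r, s}) ≤
      psiOne ends r s d ω := by
    intro e
    unfold restrictTo
    by_cases hw : e ∈ within ends (blockIn ends (Mcore ends r s d ω) y ∪ {r, s})
    · rw [if_pos hw]
    · rw [if_neg hw]; exact Bool.false_le _
  have hc'' : Conn ends (psiOne ends r s d ω) t y := conn_mono hle hc'
  rcases ht with rfl | rfl
  · exact mem_K2_iff.2 (Or.inl hc'')
  · exact mem_K2_iff.2 (Or.inr hc'')

/-- **`Ψ₁ ω` is a hub–dead-end colouring** whenever some `W`-core neighbour `y` of `d` is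
`W`-joined to `{r, s}` inside its block: `y` is in both worlds of the terminal set `{r, s, d}` of
`Ψ₁ ω`. -/
theorem HD_psiOne (hrs : ∀ e, ends e ≠ s(r, s)) {y : V} (hy : y ∈ Mcore ends r s d ω) {e₀ : E}
    (hends₀ : ends e₀ = s(d, y)) {t : V} (ht : t = r ∨ t = s)
    (hc : Conn ends (restrictTo ends (OneColourSwitch.compl ω)
      (blockIn ends (Mcore ends r s d ω) y ∪ {r, s})) t y) :
    HD ends p q r s d (psiOne ends r s d ω) := by
  refine ⟨sep2_psiOne h, DOne_psiOne h, Or.inl (mem_K2_psiOne h), ?_⟩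
  rintro ⟨_, hDZ⟩
  have hyW : y ∈ joinedW ends r s d ω := mem_joinedW_of_nbr hy hends₀
  have hyK : y ∈ K2 ends r s (psiOne ends r s d ω) := mem_K2_psiOne_of_rooted h hyW hrs ht hc
  -- `y ∈ K_H`
  have hyKH : y ∈ KH ends ({r, s, d} : Set V) (psiOne ends r s d ω) := by
    rcases mem_K2_iff.1 hyK with hc' | hc'
    · exact ⟨r, by simp, hc'⟩
    · exact ⟨s, by simp, hc'⟩
  -- `y ∈ M_H`: `W`-adjacent to `d` by the kept edge
  have he₀ : psiOne ends r s d ω e₀ = false := by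
    rw [psiOne_of_kept (mem_keptEdges_of_dW hyW hends₀)]
    exact edge_Mcore_d h hy (ends_swap hends₀)
  have hyMH : y ∈ MH ends ({r, s, d} : Set V) (psiOne ends r s d ω) :=
    mem_MH_of_closed (mem_MH_of_mem (by simp) _) he₀ hends₀
  exact hDZ y (by simp [hy.2.1, hy.2.2.1, hy.2.2.2]) hyKH hyMH

end Dirty

end NoPocket

end Summit.Ventures.PercRepro2
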